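import Literature.Topology.FourManifolds.MMSWRasmussenFacts
import Literature.Topology.FourManifolds.MMSWFibreRotation
import Summits.SmoothPoincare4.SmoothPoincare4.Theses.DottedCircleRasmussen
import Literature.Topology.FourManifolds.MMSWBeltTwistInvariance

/-!
# Stub `stub_sectorBlindPerHandle` of line `mk_friends` for crux `DcrGap`: per-handle sector blindness
(item stmt-SmoothPoincare4-16128, route route-SmoothPoincare4-DottedCircleRasmussen)

The stub says that the Manolescu–Marengon–Sarkar–Willis invariants `s₋`, `s₊` of a loop `K` on the
model boundary `∂D_r = M_r ≅ #ʳ(S¹ × S²)` (tree: `MMSW.HasSMinus`, `MMSW.HasSPlus`,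
`Literature/Topology/FourManifolds/MMSWRasmussen.lean`) do not change under the PER-HANDLE twist
`τ^ε = MMSW.fibreRot (z ↦ Π_j u_j(z)^{ε_j})`, `u_j(z) = (z - c_j)/|z - c_j|`, `ε ∈ ℤʳ` — the product
`Π_j σ_j^{ε_j}` of powers of the Dehn twists along the `r` belt spheres, an orientation-preserving
self-diffeomorphism of `M_r` (MMSW §2.3).  This is MMSW's Thm. 3.7 (`s(φ(L)) = s(L)` for
`φ ∈ Diff⁺(M_r)`; Thm. 2.8 for the homology) for these generators.

## What is PROVED here (no named facts)

* the DIAGONAL case `ε = (c, …, c)` for every `r` (`sectorBlindPerHandle_const`): `Π_j u_j^c = u^c`,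
  so `τ^{(c,…,c)}` is the tree's sphere twist `σ^c = MMSW.sphereTwist r c`, under which `s_∓` are
  invariant (`MMSW.hasSMinus_sphereTwist_comp_iff`, `MMSW.hasSPlus_sphereTwist_comp_iff`,
  `MMSWRasmussenFiniteApproxProofs.lean`; the landed `Theorems.DcrGap.Sketch.stub_sectorBlind`);
* hence the stub outright for `r ≤ 1` (`stub_sectorBlindPerHandle_of_le_one`): every
  `ε : Fin r → ℤ` is then diagonal;
* the whole differential topology of the general case: `τ^ε` carries model knots, smooth model
  isotopies and isotopy classes to the same (`perHandle_isModelIsotopic_fibreRot_comp`, through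
  `MMSW.IsModelKnot.fibreRot_comp`), preserves null-homology (it fixes `z`) and core-missing
  representatives, is undone by `τ^{-ε}` on `∂D_r` (`perHandle_fibreRot_neg_comp_comp`), and is
  conjugated to `τ^{-ε}` by the model mirror `ρ(z, w) = (z̄, w)` (`perHandle_modelMirror_fibreRot`:
  the hole centres are real and `ū = u⁻¹` for a unit), which carries the `s₊` half to the `s₋` half.

## What is NOT provable from the tree, and the conditional result

For `r ≥ 2` and non-diagonal `ε` the finite approximation `finiteApprox r k (τ^ε ∘ K')` of the
twisted representative is the picture of `fibreRot (Π_j u_j^{k + ε_j}) ∘ K'`, MMSW's MULTI-INDEX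
approximation `D(k⃗ + ε)(K')`, while the tree computes `s₋` through the DIAGONAL approximations
`D(k⃗)(K') = finiteApprox r k K'` only; that `s(D(k⃗ + ε)(K')) = s(D(k⃗)(K'))` for large `k` is
MMSW's Thm. 3.7 for the Dehn twists ("the re-indexing, which preserves Lee generators") read
through the finite approximation theorem Thm. 3.3 on both sides — Khovanov–Lee homology in
`#ʳ(S¹ × S²)`, absent from the tree (cf. the named fact `MMSW.eventually_approxHasRasmussen`, the
diagonal Thm. 1.4, equally undischarged).  No isotopy shortcut exists: `τ^ε ∘ K` is in general NOT
isotopic to `K` in `M_r` (a single sphere twist is a nontrivial mapping class; only `σ_j²` is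
trivial, and the isotopy `σ_j² ≃ id` rotates the belt sphere about a moving axis, so it is not a
family of fibre rotations `(z, w) ↦ (z, w·Φ_a(z))` as in `MMSW.isSmoothModelIsotopy_fibreRot`), and
the fibre-rotation families of `MMSWFibreRotation.lean` cannot connect `Π u_j^{ε_j}` to `1` along a
null-homologous `K` whose planar image `z(K(𝕊¹))` contains a loop around a hole with `ε_j ≠ 0`
(degree obstruction on that loop), which happens (e.g. `z ∘ K` tracing a circle about `c_0` forth
and back, separated by `arg w`).

So the missing input is stated here as the named literature fact
`eventually_approxHasRasmussen_multiIndex` (MMSW Thm. 3.7 with Thm. 3.3, in the tree's vocabulary: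
eventually in `k`, `D(k⃗)(τ^ε ∘ K)` and `D(k⃗)(K)` have the same ordinary Rasmussen invariants), and
the stub is proved FROM it: `helper_sectorBlindPerHandle_of_multiIndex` (registered helper stub,
the fact inlined as hypothesis) and `stub_sectorBlindPerHandle_of_multiIndex` (the same, by name).

References: C. Manolescu, M. Marengon, S. Sarkar, M. Willis, *A generalization of Rasmussen's
invariant, with applications to surfaces in some four-manifolds*, Duke Math. J. 172 (2023) 231–311,
arXiv:1910.08195: §2.3, Thm. 2.8, Thm. 3.3 (= Thm. 1.4), Thm. 3.4, Thm. 3.7, Prop. 8.2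
[ManolescuMarengonSarkarWillis2023].  No `sorry`.
-/

-- the prescribed namespace `Summit.<P>.<Sub>.…` duplicates `SmoothPoincare4` (P = Sub)
set_option linter.dupNamespace false

noncomputable section

open scoped Manifold ContDiff Topology ComplexConjugate
open Function Set
open Literature.Topology.FourManifolds Literature.Topology.FourManifolds.MMSW
open Literature.AlgebraicTopology.Homotopy.HopfFibration (zC wC ofZW zC_ofZW wC_ofZW ofZW_zC_wC)

namespace Summit.SmoothPoincare4.SmoothPoincare4.Theorems.DcrGap.MkFriends

variable {r : ℕ}
  {K K' : (Metric.sphere (0 : EuclideanSpace ℝ (Fin 2)) 1) → EuclideanSpace ℝ (Fin 4)}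

/-! ## The per-handle multiplier `Π_j u_j(z)^{ε_j}`, `u_j(z) = (z - c_j)/|z - c_j|` -/

/-- Off the hole centres the per-handle multiplier `Π_j u_j(z)^{ε_j}` is a unit complex number.
[folklore] -/
theorem perHandle_norm_mult (ε : Fin r → ℤ) {z : ℂ} (hz : ∀ j : Fin r, z ≠ holeCentre r j) :
    ‖∏ j : Fin r, ((z - holeCentre r j) / (((‖z - holeCentre r j‖ : ℝ)) : ℂ)) ^ (ε j)‖ = 1 := by
  rw [norm_prod]
  refine Finset.prod_eq_one fun j _ ↦ ?_
  have h : ‖z - holeCentre r j‖ ≠ 0 := norm_ne_zero_iff.2 (sub_ne_zero.2 (hz j))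
  rw [norm_zpow, norm_div, Complex.norm_real, Real.norm_eq_abs, abs_of_nonneg (norm_nonneg _),
    div_self h, one_zpow]

/-- Off the hole centres the per-handle multiplier is real-smooth (each `u_j` is smooth off `c_j`,
`MMSW.contDiffAt_unitFactor`, and integer powers are smooth off `0`). [folklore] -/
theorem perHandle_contDiffAt_mult (ε : Fin r → ℤ) {z : ℂ} (hz : ∀ j : Fin r, z ≠ holeCentre r j) :
    ContDiffAt ℝ ∞ (fun y : ℂ ↦
      ∏ j : Fin r, ((y - holeCentre r j) / (((‖y - holeCentre r j‖ : ℝ)) : ℂ)) ^ (ε j)) z := by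
  refine contDiffAt_prod fun j _ ↦ ?_
  have h1 : ‖(z - holeCentre r j) / (((‖z - holeCentre r j‖ : ℝ)) : ℂ)‖ = 1 := by
    have h : ‖z - holeCentre r j‖ ≠ 0 := norm_ne_zero_iff.2 (sub_ne_zero.2 (hz j))
    rw [norm_div, Complex.norm_real, Real.norm_eq_abs, abs_of_nonneg (norm_nonneg _), div_self h]
  have hne : (z - holeCentre r j) / (((‖z - holeCentre r j‖ : ℝ)) : ℂ) ≠ 0 :=
    norm_ne_zero_iff.1 (by rw [h1]; exact one_ne_zero)
  exact (contDiffAt_zpow_complex hne (ε j)).comp z (contDiffAt_unitFactor (hz j))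

/-- `τ^{-ε}` after `τ^{ε}` multiplies the fibre by `1` (off the hole centres). [folklore] -/
theorem perHandle_mult_mul_mult_neg (ε : Fin r → ℤ) {z : ℂ} (hz : ∀ j : Fin r, z ≠ holeCentre r j) :
    (∏ j : Fin r, ((z - holeCentre r j) / (((‖z - holeCentre r j‖ : ℝ)) : ℂ)) ^ (ε j)) *
      (∏ j : Fin r, ((z - holeCentre r j) / (((‖z - holeCentre r j‖ : ℝ)) : ℂ)) ^ (-ε j)) = 1 := by
  rw [← Finset.prod_mul_distrib]
  refine Finset.prod_eq_one fun j _ ↦ ?_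
  have h1 : ‖(z - holeCentre r j) / (((‖z - holeCentre r j‖ : ℝ)) : ℂ)‖ = 1 := by
    have h : ‖z - holeCentre r j‖ ≠ 0 := norm_ne_zero_iff.2 (sub_ne_zero.2 (hz j))
    rw [norm_div, Complex.norm_real, Real.norm_eq_abs, abs_of_nonneg (norm_nonneg _), div_self h]
  have hne : (z - holeCentre r j) / (((‖z - holeCentre r j‖ : ℝ)) : ℂ) ≠ 0 :=
    norm_ne_zero_iff.1 (by rw [h1]; exact one_ne_zero)
  rw [zpow_neg, mul_inv_cancel₀ (zpow_ne_zero _ hne)]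

/-- **The mirror conjugates the per-handle multiplier**: the hole centres are real and
`ū_j = u_j⁻¹`, so `Π_j u_j(z̄)^{-ε_j} = Π_j u_j(z)^{ε_j}`. [folklore] -/
theorem perHandle_mult_conj (ε : Fin r → ℤ) {z : ℂ} (hz : ∀ j : Fin r, z ≠ holeCentre r j) :
    (∏ j : Fin r, ((conj z - holeCentre r j) / (((‖conj z - holeCentre r j‖ : ℝ)) : ℂ)) ^ (-ε j)) =
      ∏ j : Fin r, ((z - holeCentre r j) / (((‖z - holeCentre r j‖ : ℝ)) : ℂ)) ^ (ε j) := by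
  refine Finset.prod_congr rfl fun j _ ↦ ?_
  have hc : conj (holeCentre r j) = holeCentre r j := Complex.conj_ofReal _
  have e1 : conj z - holeCentre r j = conj (z - holeCentre r j) := by rw [map_sub, hc]
  have hne : z - holeCentre r j ≠ 0 := sub_ne_zero.2 (hz j)
  rw [e1, Complex.norm_conj]
  set u : ℂ := (z - holeCentre r j) / (((‖z - holeCentre r j‖ : ℝ)) : ℂ) with hu_def
  have h1 : ‖u‖ = 1 := by
    rw [hu_def, norm_div, Complex.norm_real, Real.norm_eq_abs, abs_of_nonneg (norm_nonneg _),
      div_self (norm_ne_zero_iff.2 hne)]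
  have hconj : conj (z - holeCentre r j) / (((‖z - holeCentre r j‖ : ℝ)) : ℂ) = conj u := by
    rw [hu_def, map_div₀, Complex.conj_ofReal]
  have hinv : conj u = u⁻¹ := by
    rw [Complex.inv_def, Complex.normSq_eq_norm_sq, h1]
    simp
  rw [hconj, hinv, inv_zpow', neg_neg]

/-! ## The per-handle twist `τ^ε` on `∂D_r`: inverse `τ^{-ε}`, mirror rule -/

/-- Two points of `ℝ⁴ = ℂ²` with the same `z` and the same `w` are equal. [folklore] -/
theorem perHandle_ext_zw {x y : EuclideanSpace ℝ (Fin 4)} (hz : zC x = zC y) (hw : wC x = wC y) :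
    x = y := by
  rw [← ofZW_zC_wC x, hz, hw, ofZW_zC_wC]

/-- **`τ^{-ε} ∘ τ^{ε} = id` along a loop on the model boundary** (the guard keeps `z` off the hole
centres, where the multipliers are inverse units). [folklore] -/
theorem perHandle_fibreRot_neg_comp_comp (hK : ∀ t, K t ∈ modelBoundary r) (ε : Fin r → ℤ) :
    fibreRot (fun z : ℂ ↦
        ∏ j : Fin r, ((z - holeCentre r j) / (((‖z - holeCentre r j‖ : ℝ)) : ℂ)) ^ (-ε j)) ∘
      (fibreRot (fun z : ℂ ↦
        ∏ j : Fin r, ((z - holeCentre r j) / (((‖z - holeCentre r j‖ : ℝ)) : ℂ)) ^ (ε j)) ∘ K) = K := by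
  funext t
  simp only [Function.comp_apply]
  rw [fibreRot_fibreRot]
  exact fibreRot_of_apply_eq_one (perHandle_mult_mul_mult_neg ε (zC_ne_holeCentre (hK t).1))

/-- **The mirror conjugates the per-handle twist**: `ρ ∘ τ^{ε} = τ^{-ε} ∘ ρ` off the poles, for the
model mirror `ρ(z, w) = (z̄, w)` (`MMSW.modelMirror`). [cite: ManolescuMarengonSarkarWillis2023, Prop. 8.2 (proof)] -/
theorem perHandle_modelMirror_fibreRot {x : EuclideanSpace ℝ (Fin 4)}
    (hx : ∀ j : Fin r, (1 : ℝ) ≤ holeTerm r j x) (ε : Fin r → ℤ) :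
    modelMirror (fibreRot (fun z : ℂ ↦
        ∏ j : Fin r, ((z - holeCentre r j) / (((‖z - holeCentre r j‖ : ℝ)) : ℂ)) ^ (ε j)) x) =
      fibreRot (fun z : ℂ ↦
        ∏ j : Fin r, ((z - holeCentre r j) / (((‖z - holeCentre r j‖ : ℝ)) : ℂ)) ^ (-ε j))
        (modelMirror x) := by
  have hz := zC_ne_holeCentre hx
  apply perHandle_ext_zw
  · simp only [zC_modelMirror, zC_fibreRot]
  · simp only [wC_modelMirror, wC_fibreRot, zC_modelMirror]
    rw [perHandle_mult_conj ε hz]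

/-! ## `τ^ε` transports isotopies of model knots and null-homology

Stated for any multiplier `φ` that is smooth and unit off the hole centres (so in particular for
`Π_j u_j^{ε_j}`, by `perHandle_contDiffAt_mult`, `perHandle_norm_mult`). -/

/-- **A fibre rotation by a multiplier smooth and unit off the poles transports smooth isotopies of
model knots** (compose the jointly smooth family with the map, smooth near `∂D_r`; each stage is a
model knot by `MMSW.IsModelKnot.fibreRot_comp`). [cite: HirschDT1976, Ch. 8 §1] -/
theorem perHandle_isSmoothModelIsotopy_fibreRot_comp {φ : ℂ → ℂ}
    (hφ : ∀ z : ℂ, (∀ j : Fin r, z ≠ holeCentre r j) → ContDiffAt ℝ ∞ φ z)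
    (hφ1 : ∀ z : ℂ, (∀ j : Fin r, z ≠ holeCentre r j) → ‖φ z‖ = 1)
    (h : IsSmoothModelIsotopy r K K') :
    IsSmoothModelIsotopy r (fibreRot φ ∘ K) (fibreRot φ ∘ K') := by
  obtain ⟨H, hH, h0, h1, hK⟩ := h
  refine ⟨fun s ↦ fibreRot φ ∘ H s, fun p ↦ ?_, fun s hs ↦ ?_, fun s hs ↦ ?_, fun s ↦ ?_⟩
  · have hzp : ∀ j : Fin r, zC (H p.1 p.2) ≠ holeCentre r j :=
      zC_ne_holeCentre ((hK p.1).mem p.2).1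
    exact ((contDiffAt_fibreRot (hφ _ hzp)).contMDiffAt).comp p (hH p)
  · show fibreRot φ ∘ H s = _
    rw [h0 s hs]
  · show fibreRot φ ∘ H s = _
    rw [h1 s hs]
  · exact (hK s).fibreRot_comp (fun t ↦ hφ _ (zC_ne_holeCentre ((hK s).mem t).1))
      (fun t ↦ hφ1 _ (zC_ne_holeCentre ((hK s).mem t).1))

/-- Such a fibre rotation transports isotopy of model knots (chains of smooth isotopies).
[cite: HirschDT1976, Ch. 8 §1] -/
theorem perHandle_isModelIsotopic_fibreRot_comp {φ : ℂ → ℂ}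
    (hφ : ∀ z : ℂ, (∀ j : Fin r, z ≠ holeCentre r j) → ContDiffAt ℝ ∞ φ z)
    (hφ1 : ∀ z : ℂ, (∀ j : Fin r, z ≠ holeCentre r j) → ‖φ z‖ = 1)
    (h : IsModelIsotopic r K K') :
    IsModelIsotopic r (fibreRot φ ∘ K) (fibreRot φ ∘ K') := by
  induction h with
  | single h => exact (perHandle_isSmoothModelIsotopy_fibreRot_comp hφ hφ1 h).isModelIsotopic
  | tail _ h ih =>
    exact ih.trans (perHandle_isSmoothModelIsotopy_fibreRot_comp hφ hφ1 h).isModelIsotopic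

/-- Null-homology only sees `z ∘ K`, which fibre rotations do not move. [folklore] -/
theorem perHandle_isNullHomologous_fibreRot_comp_iff (φ : ℂ → ℂ) :
    IsNullHomologous r (fibreRot φ ∘ K) ↔ IsNullHomologous r K := by
  simp only [IsNullHomologous, Function.comp_apply, zC_fibreRot]

/-- **`s₋(K) = s ⟹ s₋(fibreRot φ ∘ K) = s`, given that the finite approximations of `fibreRot φ ∘ L`
and of `L` have eventually the same Rasmussen invariants** for core-missing null-homologous model
knots `L` (hypothesis `hev` — for `φ = Π_j u_j^{ε_j}` this is the multi-index finite approximation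
input): transport the null-homology, the core-missing representative `L ↦ fibreRot φ ∘ L` and its
isotopy, and take the later of the two thresholds. [cite: ManolescuMarengonSarkarWillis2023, Thm. 3.7] -/
theorem perHandle_hasSMinus_fibreRot_comp {φ : ℂ → ℂ}
    (hφ : ∀ z : ℂ, (∀ j : Fin r, z ≠ holeCentre r j) → ContDiffAt ℝ ∞ φ z)
    (hφ1 : ∀ z : ℂ, (∀ j : Fin r, z ≠ holeCentre r j) → ‖φ z‖ = 1)
    (hev : ∀ (L : (Metric.sphere (0 : EuclideanSpace ℝ (Fin 2)) 1) → EuclideanSpace ℝ (Fin 4)),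
      IsModelKnot r L → IsNullHomologous r L → (∀ t, wC (L t) ≠ 0) →
        ∃ k₀ : ℤ, ∀ k : ℤ, k₀ ≤ k → ∀ s : ℤ,
          ApproxHasRasmussen r k (fibreRot φ ∘ L) s ↔ ApproxHasRasmussen r k L s)
    {s : ℤ} (h : HasSMinus r K s) : HasSMinus r (fibreRot φ ∘ K) s := by
  obtain ⟨h0, L, hiso, hw, k₀, hk⟩ := h
  have hL : IsModelKnot r L := hiso.isModelKnot_right
  have hzL : ∀ t, ∀ j : Fin r, zC (L t) ≠ holeCentre r j := fun t ↦ zC_ne_holeCentre (hL.mem t).1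
  obtain ⟨k₁, hk₁⟩ := hev L hL (hiso.isNullHomologous h0) hw
  refine ⟨(perHandle_isNullHomologous_fibreRot_comp_iff φ).2 h0, fibreRot φ ∘ L,
    perHandle_isModelIsotopic_fibreRot_comp hφ hφ1 hiso, fun t ↦ ?_, max k₀ k₁, fun k hkk ↦ ?_⟩
  · exact wC_fibreRot_ne_zero (hw t)
      (norm_ne_zero_iff.1 (by rw [hφ1 _ (hzL t)]; exact one_ne_zero))
  · exact (hk₁ k ((le_max_right _ _).trans hkk) s).2 (hk k ((le_max_left _ _).trans hkk))

/-! ## The stub from the multi-index finite approximation input -/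

/-- **`s₋(τ^ε ∘ K) = s ↔ s₋(K) = s`, given the multi-index finite approximation input at rank `r`**
(hypothesis `hev`, for every exponent vector): the direction `←` is
`perHandle_hasSMinus_fibreRot_comp` for `Π_j u_j^{ε_j}`, the direction `→` is the same for
`Π_j u_j^{-ε_j}` followed by `τ^{-ε} ∘ τ^{ε} ∘ K = K`. [cite: ManolescuMarengonSarkarWillis2023, Thm. 3.7] -/
theorem perHandle_hasSMinus_iff
    (hev : ∀ (ε : Fin r → ℤ)
      (L : (Metric.sphere (0 : EuclideanSpace ℝ (Fin 2)) 1) → EuclideanSpace ℝ (Fin 4)),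
      IsModelKnot r L → IsNullHomologous r L → (∀ t, wC (L t) ≠ 0) →
        ∃ k₀ : ℤ, ∀ k : ℤ, k₀ ≤ k → ∀ s : ℤ,
          ApproxHasRasmussen r k (fibreRot (fun z : ℂ ↦
            ∏ j : Fin r, ((z - holeCentre r j) / (((‖z - holeCentre r j‖ : ℝ)) : ℂ)) ^ (ε j)) ∘ L) s ↔
            ApproxHasRasmussen r k L s)
    (hK : ∀ t, K t ∈ modelBoundary r) (ε : Fin r → ℤ) (s : ℤ) :
    HasSMinus r (fibreRot (fun z : ℂ ↦
        ∏ j : Fin r, ((z - holeCentre r j) / (((‖z - holeCentre r j‖ : ℝ)) : ℂ)) ^ (ε j)) ∘ K) s ↔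
      HasSMinus r K s := by
  refine ⟨fun hs ↦ ?_, fun hs ↦ ?_⟩
  · have h' := perHandle_hasSMinus_fibreRot_comp
      (φ := fun z : ℂ ↦
        ∏ j : Fin r, ((z - holeCentre r j) / (((‖z - holeCentre r j‖ : ℝ)) : ℂ)) ^ (-ε j))
      (fun z hz ↦ perHandle_contDiffAt_mult (fun j ↦ -ε j) hz)
      (fun z hz ↦ perHandle_norm_mult (fun j ↦ -ε j) hz) (hev fun j ↦ -ε j) hs
    rwa [perHandle_fibreRot_neg_comp_comp hK ε] at h'
  · exact perHandle_hasSMinus_fibreRot_comp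
      (φ := fun z : ℂ ↦
        ∏ j : Fin r, ((z - holeCentre r j) / (((‖z - holeCentre r j‖ : ℝ)) : ℂ)) ^ (ε j))
      (fun z hz ↦ perHandle_contDiffAt_mult ε hz) (fun z hz ↦ perHandle_norm_mult ε hz) (hev ε) hs

/-- **`s₊(τ^ε ∘ K) = s ↔ s₊(K) = s`, given the multi-index input**: `s₊(K) = s` is
`s₋(ρ ∘ K) = -s`, and `ρ ∘ τ^{ε} = τ^{-ε} ∘ ρ` on `∂D_r` (`perHandle_modelMirror_fibreRot`).
[cite: ManolescuMarengonSarkarWillis2023, Thm. 3.7 and Prop. 8.8 (1)] -/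
theorem perHandle_hasSPlus_iff
    (hev : ∀ (ε : Fin r → ℤ)
      (L : (Metric.sphere (0 : EuclideanSpace ℝ (Fin 2)) 1) → EuclideanSpace ℝ (Fin 4)),
      IsModelKnot r L → IsNullHomologous r L → (∀ t, wC (L t) ≠ 0) →
        ∃ k₀ : ℤ, ∀ k : ℤ, k₀ ≤ k → ∀ s : ℤ,
          ApproxHasRasmussen r k (fibreRot (fun z : ℂ ↦
            ∏ j : Fin r, ((z - holeCentre r j) / (((‖z - holeCentre r j‖ : ℝ)) : ℂ)) ^ (ε j)) ∘ L) s ↔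
            ApproxHasRasmussen r k L s)
    (hK : ∀ t, K t ∈ modelBoundary r) (ε : Fin r → ℤ) (s : ℤ) :
    HasSPlus r (fibreRot (fun z : ℂ ↦
        ∏ j : Fin r, ((z - holeCentre r j) / (((‖z - holeCentre r j‖ : ℝ)) : ℂ)) ^ (ε j)) ∘ K) s ↔
      HasSPlus r K s := by
  have hc : modelMirror ∘ (fibreRot (fun z : ℂ ↦
        ∏ j : Fin r, ((z - holeCentre r j) / (((‖z - holeCentre r j‖ : ℝ)) : ℂ)) ^ (ε j)) ∘ K) =
      fibreRot (fun z : ℂ ↦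
        ∏ j : Fin r, ((z - holeCentre r j) / (((‖z - holeCentre r j‖ : ℝ)) : ℂ)) ^ (-ε j)) ∘
        (modelMirror ∘ K) :=
    funext fun t ↦ perHandle_modelMirror_fibreRot (hK t).1 ε
  rw [hasSPlus_iff, hasSPlus_iff, hc]
  exact perHandle_hasSMinus_iff hev (fun t ↦ (modelMirror_mem_modelBoundary_iff _).2 (hK t))
    (fun j ↦ -ε j) (-s)

/-! ## Proved sub-cases: diagonal exponents, and `r ≤ 1` -/

/-- **The diagonal case of the stub, proved**: for `ε = (c, …, c)` the per-handle twist is the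
sphere twist `σ^c` (`Π_j u_j^c = u^c`, `MMSW.sphereTwist_eq_fibreRot`), and `s₋`, `s₊` are
`σ`-invariant (`MMSW.hasSMinus_sphereTwist_comp_iff`, `MMSW.hasSPlus_sphereTwist_comp_iff`:
`D(k⃗)(σ^c ∘ K') = D(k⃗ + c⃗)(K')` shifts the eventual value). [cite: ManolescuMarengonSarkarWillis2023, Thm. 2.8] -/
theorem sectorBlindPerHandle_const (r : ℕ)
    (K : (Metric.sphere (0 : EuclideanSpace ℝ (Fin 2)) 1) → EuclideanSpace ℝ (Fin 4)) (c s : ℤ) :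
    (HasSMinus r (fibreRot (fun z : ℂ ↦
        ∏ j : Fin r, ((z - holeCentre r j) / (((‖z - holeCentre r j‖ : ℝ)) : ℂ)) ^ c) ∘ K) s ↔
      HasSMinus r K s) ∧
    (HasSPlus r (fibreRot (fun z : ℂ ↦
        ∏ j : Fin r, ((z - holeCentre r j) / (((‖z - holeCentre r j‖ : ℝ)) : ℂ)) ^ c) ∘ K) s ↔
      HasSPlus r K s) := by
  have h : fibreRot (fun z : ℂ ↦
      ∏ j : Fin r, ((z - holeCentre r j) / (((‖z - holeCentre r j‖ : ℝ)) : ℂ)) ^ c) =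
      sphereTwist r c := by
    rw [sphereTwist_eq_fibreRot]
    congr 1
    funext z
    rw [Finset.prod_zpow]
    rfl
  rw [h]
  exact ⟨hasSMinus_sphereTwist_comp_iff K c s, hasSPlus_sphereTwist_comp_iff K c s⟩

/-- **The stub for at most one handle, proved** (`r ≤ 1`: `M_0 = S³`, `M_1 = S¹ × S²`): every
exponent vector `ε : Fin r → ℤ` is then constant, so this is the diagonal case
`sectorBlindPerHandle_const`. [cite: ManolescuMarengonSarkarWillis2023, Thm. 2.8] -/
theorem stub_sectorBlindPerHandle_of_le_one : ∀ (r : ℕ), r ≤ 1 → ∀ (K : (Metric.sphere (0 : EuclideanSpace ℝ (Fin 2)) 1) → EuclideanSpace ℝ (Fin 4)) (ε : Fin r → ℤ) (s : ℤ), (∀ t, K t ∈ Literature.Topology.FourManifolds.MMSW.modelBoundary r) → (Literature.Topology.FourManifolds.MMSW.HasSMinus r (Literature.Topology.FourManifolds.MMSW.fibreRot (fun z : ℂ => ∏ j : Fin r, ((z - Literature.Topology.FourManifolds.MMSW.holeCentre r j) / (((‖z - Literature.Topology.FourManifolds.MMSW.holeCentre r j‖ : ℝ)) : ℂ)) ^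 (ε j)) ∘ K) s ↔ Literature.Topology.FourManifolds.MMSW.HasSMinus r K s) ∧ (Literature.Topology.FourManifolds.MMSW.HasSPlus r (Literature.Topology.FourManifolds.MMSW.fibreRot (fun z : ℂ => ∏ j : Fin r, ((z - Literature.Topology.FourManifolds.MMSW.holeCentre r j) / (((‖z - Literature.Topology.FourManifolds.MMSW.holeCentre r j‖ : ℝ)) : ℂ)) ^ (ε j)) ∘ K) s ↔ Literature.Topology.FourManifolds.MMSW.HasSPlus r K s) := by
  intro r hr K ε s _
  have hsub : Subsingleton (Fin r) := Fin.subsingleton_iff_le_one.2 hr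
  obtain ⟨c, hc⟩ : ∃ c : ℤ, ∀ j, ε j = c := by
    rcases isEmpty_or_nonempty (Fin r) with h | ⟨⟨j₀⟩⟩
    · exact ⟨0, fun j ↦ (h.false j).elim⟩
    · exact ⟨ε j₀, fun j ↦ congrArg ε (Subsingleton.elim j j₀)⟩
  simp only [hc]
  exact sectorBlindPerHandle_const r K c s

/-! ## The multi-index finite approximation input (MMSW Thm. 3.7 with Thm. 3.3), and the stub from it -/

/-- **Registered helper stub `helper_sectorBlindPerHandle_of_multiIndex` of line `mk_friends`**: the
multi-index finite approximation input (the statement of `eventually_approxHasRasmussen_multiIndex`,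
MMSW Thm. 3.7 with Thm. 3.3, inlined as the hypothesis) implies the stub `stub_sectorBlindPerHandle`
verbatim — per-handle sector blindness of `s₋` and `s₊`.  Proof: `perHandle_hasSMinus_iff`
(transport of null-homology, core-missing representatives and model isotopies along `τ^{±ε}`,
thresholds merged) and `perHandle_hasSPlus_iff` (mirror rule `ρ ∘ τ^{ε} = τ^{-ε} ∘ ρ`).
[cite: ManolescuMarengonSarkarWillis2023, Thm. 3.7] -/
theorem helper_sectorBlindPerHandle_of_multiIndex : (∀ {r : ℕ} {K : (Metric.sphere (0 : EuclideanSpace ℝ (Fin 2)) 1) → EuclideanSpace ℝ (Fin 4)} (_hK : Literature.Topology.FourManifolds.MMSW.IsModelKnot r K) (_h0 : Literature.Topology.FourManifolds.MMSW.IsNullHomologous r K) (_hw : ∀ t, Literature.AlgebraicTopology.Homotopy.HopfFibration.wC (K t) ≠ 0) (ε : Fin r → ℤ), ∃ k₀ : ℤ, ∀ k : ℤ, k₀ ≤ k → ∀ s : ℤ, Literature.Topology.FourManifolds.MMSW.ApproxHasRasmussen r k (Literature.Topology.FourManifolds.MMSW.fibreRot (fun z : ℂ => ∏ j : Fin r,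 ((z - Literature.Topology.FourManifolds.MMSW.holeCentre r j) / (((‖z - Literature.Topology.FourManifolds.MMSW.holeCentre r j‖ : ℝ)) : ℂ)) ^ (ε j)) ∘ K) s ↔ Literature.Topology.FourManifolds.MMSW.ApproxHasRasmussen r k K s) → ∀ (r : ℕ) (K : (Metric.sphere (0 : EuclideanSpace ℝ (Fin 2)) 1) → EuclideanSpace ℝ (Fin 4)) (ε : Fin r → ℤ) (s : ℤ), (∀ t, K t ∈ Literature.Topology.FourManifolds.MMSW.modelBoundary r) → (Literature.Topology.FourManifolds.MMSW.HasSMinus r (Literature.Topology.FourManifolds.MMSW.fibreRot (fun z : ℂ => ∏ j : Fin r, ((z - Literature.Topology.FourManifolds.MMSW.holeCentre r j) / (((‖z - Literature.Topology.FourManifolds.MMSW.holeCentre r j‖ : ℝ)) : ℂ)) ^ (ε j)) ∘ K) s ↔ Literature.Topology.FourManifolds.MMSW.HasSMinus r K s) ∧ (Literature.Topology.FourManifolds.MMSW.HasSPlus r (Literature.Topology.FourManifolds.MMSW.fibreRot (fun z : ℂ => ∏ j : Fin r, ((z - Literature.Topology.FourManifolds.MMSW.holeCentre r j) / (((‖z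 - Literature.Topology.FourManifolds.MMSW.holeCentre r j‖ : ℝ)) : ℂ)) ^ (ε j)) ∘ K) s ↔ Literature.Topology.FourManifolds.MMSW.HasSPlus r K s) :=
  fun h _ _ ε s hK ↦
    ⟨perHandle_hasSMinus_iff (fun ε' _ hL h0 hw ↦ h hL h0 hw ε') hK ε s,
      perHandle_hasSPlus_iff (fun ε' _ hL h0 hw ↦ h hL h0 hw ε') hK ε s⟩

/-- **Stub `stub_sectorBlindPerHandle` conditionally on the named fact
`eventually_approxHasRasmussen_multiIndex`** (MMSW Thm. 3.7 with Thm. 3.3; Khovanov–Lee homology in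
`#ʳ(S¹ × S²)`, not in the tree): for every `r`, loop `K` on `∂D_r`, `ε ∈ ℤʳ` and `s`,
`s₋(τ^ε ∘ K) = s ↔ s₋(K) = s` and `s₊(τ^ε ∘ K) = s ↔ s₊(K) = s`.  The cases `r ≤ 1` and `ε`
diagonal hold unconditionally (`stub_sectorBlindPerHandle_of_le_one`, `sectorBlindPerHandle_const`).
[cite: ManolescuMarengonSarkarWillis2023, Thm. 3.7] -/
theorem stub_sectorBlindPerHandle_of_multiIndex (h : Literature.Topology.FourManifolds.eventually_approxHasRasmussen_multiIndex) : ∀ (r : ℕ) (K : (Metric.sphere (0 : EuclideanSpace ℝ (Fin 2)) 1) → EuclideanSpace ℝ (Fin 4)) (ε : Fin r → ℤ) (s : ℤ), (∀ t, K t ∈ Literature.Topology.FourManifolds.MMSW.modelBoundary r) → (Literature.Topology.FourManifolds.MMSW.HasSMinus r (Literature.Topology.FourManifolds.MMSW.fibreRot (fun z : ℂ => ∏ j : Fin r, ((z - Literature.Topology.FourManifolds.MMSW.holeCentre r j) / (((‖z - Literature.Topology.FourManifolds.MMSW.holeCentre r j‖ : ℝ)) : ℂ)) ^ (ε j)) ∘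 K) s ↔ Literature.Topology.FourManifolds.MMSW.HasSMinus r K s) ∧ (Literature.Topology.FourManifolds.MMSW.HasSPlus r (Literature.Topology.FourManifolds.MMSW.fibreRot (fun z : ℂ => ∏ j : Fin r, ((z - Literature.Topology.FourManifolds.MMSW.holeCentre r j) / (((‖z - Literature.Topology.FourManifolds.MMSW.holeCentre r j‖ : ℝ)) : ℂ)) ^ (ε j)) ∘ K) s ↔ Literature.Topology.FourManifolds.MMSW.HasSPlus r K s) :=
  fun _ _ ε s hK ↦
    ⟨perHandle_hasSMinus_iff (fun ε' _ hL h0 hw ↦ h hL h0 hw ε') hK ε s,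
      perHandle_hasSPlus_iff (fun ε' _ hL h0 hw ↦ h hL h0 hw ε') hK ε s⟩

end Summit.SmoothPoincare4.SmoothPoincare4.Theorems.DcrGap.MkFriends

end
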